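import Summits.QuantumFields.YangMills.Theorems.FradkinShenkerFlowFiniteSusceptibilityWeakCouplingSiblingFunnel

/-!
# Crux `FiniteSusceptibilityWeakCoupling` (item stmt-QuantumFields-9442): the funnel for an arbitrary summable
# majorant, and the power-law attachment

Support file for item stmt-QuantumFields-9442 (route `FradkinShenkerFlow` of `YangMills`, line
`sup-axis-reflection-transfer`). `Theorems/FradkinShenkerFlowFiniteSusceptibilityWeakCouplingSiblingFunnel.lean` reduces
the crux to time-axis cubic moments (`finiteSusceptibilityWeakCoupling_of_axialCubicMoment`) and attaches every
EXPONENTIAL time-clustering statement (`…_of_timeClusteringEventually`). Exponential decay is more than the funnel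
needs: the reflection-positivity funnel consumes only `Σ_n (n+1)³ |Cov_S(A, τ_{n e₀} B)| ≤ M(A, B, β)` uniformly in
the torus, so ANY volume-uniform majorant `|corr_S(n)| ≤ C(A,B) g(n)` (`S ≥ S₀(A,B)`, `n ≤ S`) with
`Σ (n+1)³ g(n) < ∞` closes the crux. This file proves that general form and its power-law instance
(`g(n) = (n+1)^{-q}`, `q > 4`, the borderline being the free-field exponent `2Δ = 8 > 4` of `tr F²` versus the
abelian `2Δ = 4`, cf. `Cruxes/FiniteSusceptibilityWeakCoupling/Disproof.lean` §2), so that routes proving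
polynomial infrared bounds at weak coupling (no rate) attach to item 9442 by one modus ponens as well.

* `axialMoments_of_majorantAt` : at fixed `(G, r, β)`, a summable-cubic-moment majorant for every pair ⇒ the
  axial cubic-moment bound for every pair (finitely many small tori absorbed by `|Cov| ≤ 4‖A‖∞‖B‖∞`);
* `finiteSusceptibilityWeakCoupling_of_majorantDecayEventually` : (∀ simple `G` ∀ `r` ∃ `β₁` ∀ `β ≥ β₁` ∃ such a
  majorant) ⇒ crux;
* `summable_cube_mul_rpow_neg` : `Σ (n+1)³ (n+1)^{-q} < ∞` for `q > 4`;
* `finiteSusceptibilityWeakCoupling_of_powerLawDecayEventually` : volume-uniform power-law time decay with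
  exponent `q > 4` at every `β ≥ β₁(G, r)` ⇒ crux.

All statements hold for every compact `G`; simplicity is only carried through the hypotheses. No definition is
introduced. Mathematics: the landed RP funnel + `Σ (n+1)^{3-q} < ∞ ⇔ q > 4`.
-/

noncomputable section

open MeasureTheory ProbabilityTheory
open scoped BigOperators
open Literature.MathematicalPhysics.QuantumFieldTheory hiding Site ZdEdge
open Literature.MathematicalPhysics.QuantumLattice
open Literature.Probability.LatticeModels hiding configShift configShift_apply

namespace Summit.QuantumFields.YangMills.Theorems.FiniteSusceptibilityWeakCoupling

namespace MajorantFunnel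

variable {G : Type} [Group G] [TopologicalSpace G] [IsTopologicalGroup G] [CompactSpace G]
  [MeasurableSpace G] [BorelSpace G]

/-- **Majorant ⇒ cubic moments at fixed `(G, r, β)`.** If `g ≥ 0` has `Σ (n+1)³ g(n) < ∞` and every pair of
species has a volume-uniform bound `|corr_S(n)| ≤ C g(n)` for `S ≥ S₀`, `n ≤ S` (constant and threshold per pair),
then every pair has bounded time-axis cubic moments, uniformly in the torus:
`Σ_{n ≤ S} (n+1)³ |Cov| ≤ |C| Σ_n (n+1)³ g(n)` for `S ≥ S₀`, and `≤ S₀⁴ · 4‖A‖∞‖B‖∞` for `S < S₀`. -/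
theorem axialMoments_of_majorantAt (r : LatticeRep G) (β : ℝ) {g : ℕ → ℝ} (hg0 : ∀ n, 0 ≤ g n)
    (hgs : Summable fun n : ℕ => ((n : ℝ) + 1) ^ 3 * g n)
    (hAB : ∀ A B : YMSpecies G, ∃ (C : ℝ) (S₀ : ℕ), ∀ S : ℕ, S₀ ≤ S → ∀ n : ℕ, n ≤ S →
        |latticeConnectedCorr r.ρ β (2 * S + 1) A.F B.F n| ≤ C * g n) :
    ∀ A B : YMSpecies G, ∃ M : ℝ, ∀ S : ℕ,
      ∑ n ∈ Finset.range (S + 1), ((n : ℝ) + 1) ^ 3 *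
        |cov[fun U => A.F (torusLift (2 * S + 1) U),
            fun U => B.F (configShift (-(Pi.single 0 (n : ℤ))) (torusLift (2 * S + 1) U));
            wilsonMeasure (d := 4) (L := 2 * S + 1) r.ρ β]| ≤ M := by
  intro A B
  obtain ⟨C, S₀, hC⟩ := hAB A B
  obtain ⟨a, ha⟩ := A.bounded
  obtain ⟨b, hb⟩ := B.bounded
  have hab : 0 ≤ 4 * a * b := by
    have ha0 : 0 ≤ a := (abs_nonneg _).trans (ha fun _ => 1)
    have hb0 : 0 ≤ b := (abs_nonneg _).trans (hb fun _ => 1)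
    positivity
  set T : ℝ := ∑' n : ℕ, ((n : ℝ) + 1) ^ 3 * g n with hT
  have hT0 : 0 ≤ T := tsum_nonneg fun n => mul_nonneg (by positivity) (hg0 n)
  refine ⟨|C| * T + (S₀ : ℝ) ^ 4 * (4 * a * b), fun S => ?_⟩
  haveI : IsProbabilityMeasure (wilsonMeasure (d := 4) (L := 2 * S + 1) r.ρ β) :=
    isProbabilityMeasure_wilsonMeasure _ r.continuous β
  by_cases hS : S₀ ≤ S
  · calc ∑ n ∈ Finset.range (S + 1), ((n : ℝ) + 1) ^ 3 *
            |cov[fun U => A.F (torusLift (2 * S + 1) U),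
                fun U => B.F (configShift (-(Pi.single 0 (n : ℤ))) (torusLift (2 * S + 1) U));
                wilsonMeasure (d := 4) (L := 2 * S + 1) r.ρ β]|
          ≤ ∑ n ∈ Finset.range (S + 1), |C| * (((n : ℝ) + 1) ^ 3 * g n) := by
            refine Finset.sum_le_sum fun n hn => ?_
            have hn' : n ≤ S := Nat.lt_succ_iff.mp (Finset.mem_range.mp hn)
            have h1 := hC S hS n hn'
            rw [← SiblingFunnel.covariance_eq_latticeConnectedCorr r β A B S n] at h1
            have h2 : C * g n ≤ |C| * g n := mul_le_mul_of_nonneg_right (le_abs_self C) (hg0 n)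
            calc ((n : ℝ) + 1) ^ 3 * |cov[fun U => A.F (torusLift (2 * S + 1) U),
                    fun U => B.F (configShift (-(Pi.single 0 (n : ℤ))) (torusLift (2 * S + 1) U));
                    wilsonMeasure (d := 4) (L := 2 * S + 1) r.ρ β]|
                ≤ ((n : ℝ) + 1) ^ 3 * (|C| * g n) :=
                  mul_le_mul_of_nonneg_left (h1.trans h2) (by positivity)
              _ = |C| * (((n : ℝ) + 1) ^ 3 * g n) := by ring
      _ = |C| * ∑ n ∈ Finset.range (S + 1), ((n : ℝ) + 1) ^ 3 * g n := by rw [Finset.mul_sum]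
      _ ≤ |C| * T := by
            refine mul_le_mul_of_nonneg_left ?_ (abs_nonneg C)
            exact hgs.sum_le_tsum _ fun n _ => mul_nonneg (by positivity) (hg0 n)
      _ ≤ |C| * T + (S₀ : ℝ) ^ 4 * (4 * a * b) := le_add_of_nonneg_right (by positivity)
  · push Not at hS
    calc ∑ n ∈ Finset.range (S + 1), ((n : ℝ) + 1) ^ 3 *
            |cov[fun U => A.F (torusLift (2 * S + 1) U),
                fun U => B.F (configShift (-(Pi.single 0 (n : ℤ))) (torusLift (2 * S + 1) U));
                wilsonMeasure (d := 4) (L := 2 * S + 1) r.ρ β]|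
          ≤ ∑ _n ∈ Finset.range (S + 1), (S₀ : ℝ) ^ 3 * (4 * a * b) := by
            refine Finset.sum_le_sum fun n hn => ?_
            have hn' : n ≤ S := Nat.lt_succ_iff.mp (Finset.mem_range.mp hn)
            have hnS : (n : ℝ) + 1 ≤ S₀ := by exact_mod_cast (show n + 1 ≤ S₀ by omega)
            have hcov : |cov[fun U => A.F (torusLift (2 * S + 1) U),
                fun U => B.F (configShift (-(Pi.single 0 (n : ℤ))) (torusLift (2 * S + 1) U));
                wilsonMeasure (d := 4) (L := 2 * S + 1) r.ρ β]| ≤ 4 * a * b :=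
              Negative.abs_covariance_le_of_abs_le (fun U => ha _) (fun U => hb _)
            exact mul_le_mul (pow_le_pow_left₀ (by positivity) hnS 3) hcov (abs_nonneg _) (by positivity)
      _ = ((S + 1 : ℕ) : ℝ) * ((S₀ : ℝ) ^ 3 * (4 * a * b)) := by
            rw [Finset.sum_const, Finset.card_range, nsmul_eq_mul]
      _ ≤ (S₀ : ℝ) * ((S₀ : ℝ) ^ 3 * (4 * a * b)) := by
            refine mul_le_mul_of_nonneg_right ?_ (by positivity)
            exact_mod_cast (show S + 1 ≤ S₀ by omega)
      _ = (S₀ : ℝ) ^ 4 * (4 * a * b) := by ring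
      _ ≤ |C| * T + (S₀ : ℝ) ^ 4 * (4 * a * b) := le_add_of_nonneg_left (by positivity)

/-- **Power-law weights are summable against cubic moments iff the exponent exceeds `4`** (the direction used):
`Σ_n (n+1)³ (n+1)^{-q} = Σ_n (n+1)^{3-q} < ∞` for `q > 4`. -/
theorem summable_cube_mul_rpow_neg {q : ℝ} (hq : 4 < q) :
    Summable fun n : ℕ => ((n : ℝ) + 1) ^ 3 * ((n : ℝ) + 1) ^ (-q) := by
  have h1 : Summable fun n : ℕ => ((((n + 1 : ℕ) : ℝ)) ^ (q - 3))⁻¹ :=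
    (summable_nat_add_iff 1).2 (Real.summable_nat_rpow_inv.2 (by linarith : 1 < q - 3))
  refine h1.congr fun n => ?_
  have hn : (0 : ℝ) < (n : ℝ) + 1 := by positivity
  rw [Nat.cast_succ, ← Real.rpow_neg hn.le, ← Real.rpow_natCast _ 3, ← Real.rpow_add hn]
  congr 1
  push_cast
  ring

end MajorantFunnel

open MajorantFunnel

/-- **Summable majorant ⇒ crux.** For every compact simple `G` and every `r`: if beyond some `β₁(G, r)` every
coupling admits a non-negative majorant `g` with `Σ (n+1)³ g(n) < ∞` such that each pair of species has a
volume-uniform bound `|corr_{β,S}(A, B; n)| ≤ C(A,B) g(n)` for `S ≥ S₀(A,B)`, `n ≤ S`, then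
`FiniteSusceptibilityWeakCoupling` holds. (The exponential case `g(n) = e^{-mn}` is
`finiteSusceptibilityWeakCoupling_of_timeClusteringEventually`.) -/
theorem finiteSusceptibilityWeakCoupling_of_majorantDecayEventually
    (h : ∀ (G : Type) [Group G] [TopologicalSpace G] [IsTopologicalGroup G] [CompactSpace G]
      [MeasurableSpace G] [BorelSpace G], IsCompactSimpleLieGroup G → ∀ (r : LatticeRep G),
      ∃ β₁ : ℝ, ∀ β : ℝ, β₁ ≤ β → ∃ g : ℕ → ℝ, (∀ n, 0 ≤ g n) ∧
        (Summable fun n : ℕ => ((n : ℝ) + 1) ^ 3 * g n) ∧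
        ∀ A B : YMSpecies G, ∃ (C : ℝ) (S₀ : ℕ), ∀ S : ℕ, S₀ ≤ S → ∀ n : ℕ, n ≤ S →
          |latticeConnectedCorr r.ρ β (2 * S + 1) A.F B.F n| ≤ C * g n) :
    Summit.QuantumFields.YangMills.Theses.FradkinShenkerFlow.FiniteSusceptibilityWeakCoupling := by
  refine finiteSusceptibilityWeakCoupling_of_axialCubicMoment fun G _ _ _ _ _ _ hG r => ?_
  obtain ⟨β₁, hβ₁⟩ := h G hG r
  refine ⟨β₁, fun β hβ => ?_⟩
  obtain ⟨g, hg0, hgs, hAB⟩ := hβ₁ β hβ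
  exact axialMoments_of_majorantAt r β hg0 hgs hAB

/-- **Power-law time decay (exponent `> 4`) ⇒ crux.** For every compact simple `G` and every `r`: if beyond some
`β₁(G, r)` there is, at every coupling, an exponent `q > 4` such that each pair of species satisfies the
volume-uniform bound `|corr_{β,S}(A, B; n)| ≤ C(A,B) (n+1)^{-q}` for `S ≥ S₀(A,B)`, `n ≤ S`, then
`FiniteSusceptibilityWeakCoupling` holds — no exponential rate is needed by the reflection-positivity funnel. -/
theorem finiteSusceptibilityWeakCoupling_of_powerLawDecayEventually
    (h : ∀ (G : Type) [Group G] [TopologicalSpace G] [IsTopologicalGroup G] [CompactSpace G]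
      [MeasurableSpace G] [BorelSpace G], IsCompactSimpleLieGroup G → ∀ (r : LatticeRep G),
      ∃ β₁ : ℝ, ∀ β : ℝ, β₁ ≤ β → ∃ q : ℝ, 4 < q ∧
        ∀ A B : YMSpecies G, ∃ (C : ℝ) (S₀ : ℕ), ∀ S : ℕ, S₀ ≤ S → ∀ n : ℕ, n ≤ S →
          |latticeConnectedCorr r.ρ β (2 * S + 1) A.F B.F n| ≤ C * ((n : ℝ) + 1) ^ (-q)) :
    Summit.QuantumFields.YangMills.Theses.FradkinShenkerFlow.FiniteSusceptibilityWeakCoupling := by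
  refine finiteSusceptibilityWeakCoupling_of_majorantDecayEventually fun G _ _ _ _ _ _ hG r => ?_
  obtain ⟨β₁, hβ₁⟩ := h G hG r
  refine ⟨β₁, fun β hβ => ?_⟩
  obtain ⟨q, hq, hAB⟩ := hβ₁ β hβ
  exact ⟨fun n => ((n : ℝ) + 1) ^ (-q), fun n => Real.rpow_nonneg (by positivity) _,
    summable_cube_mul_rpow_neg hq, hAB⟩

/-- **Registered form** (stub `stub_cruxOfPowerLawDecay` of item stmt-QuantumFields-9442; signature `let`-free and fully
qualified): volume-uniform power-law decay in Euclidean time with exponent `q > 4` at every `β ≥ β₁(G, r)` implies the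
crux `FiniteSusceptibilityWeakCoupling`. -/
theorem stub_cruxOfPowerLawDecay : (∀ (G : Type) [Group G] [TopologicalSpace G] [IsTopologicalGroup G] [CompactSpace G] [MeasurableSpace G] [BorelSpace G], Literature.MathematicalPhysics.QuantumFieldTheory.IsCompactSimpleLieGroup G → ∀ (r : Literature.MathematicalPhysics.QuantumFieldTheory.LatticeRep G), ∃ β₁ : ℝ, ∀ β : ℝ, β₁ ≤ β → ∃ q : ℝ, 4 < q ∧ ∀ A B : Literature.MathematicalPhysics.QuantumFieldTheory.YMSpecies G, ∃ (C : ℝ) (S₀ : ℕ), ∀ S : ℕ, S₀ ≤ S → ∀ n : ℕ, n ≤ S → |Literature.MathematicalPhysics.QuantumFieldTheory.latticeConnectedCorr r.ρ β (2 * S + 1) A.F B.F n| ≤ C * ((n : ℝ) + 1) ^ (-q)) → Summit.QuantumFields.YangMills.Theses.FradkinShenkerFlow.FiniteSusceptibilityWeakCoupling :=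
  finiteSusceptibilityWeakCoupling_of_powerLawDecayEventually

end Summit.QuantumFields.YangMills.Theorems.FiniteSusceptibilityWeakCoupling

end
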